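import Literature.Barriers.Parity.FordMaynardPrimeSieves
import Literature.NumberTheory.LFunctions.MertensSecondLogPower
import Literature.NumberTheory.Sieve.MaynardSieveLemma52
import Mathlib.Analysis.SpecialFunctions.Pow.Asymptotics
import HarnessLib

/-!
# Ford–Maynard, Theorem 4.16: PROOF of the catalogue fact `FordMaynardLowLevel`

This file discharges the named fact `Literature.Barriers.Parity.FordMaynardLowLevel`
(`FordMaynardPrimeSieves.lean`; K. Ford, J. Maynard, *On the theory of prime producing sieves*,
arXiv:2407.14368, Theorem 4.16, with the hypothesis `γ < 1 − θ − ν` its printed proof uses):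

* `FordMaynardLowLevel_holds : FordMaynardLowLevel` — for `(γ, θ, ν) ∈ 𝒬₀` with `γ < 1/2`,
  `γ ∉ [θ, θ + ν]`, `γ < 1 − θ − ν` and every `B > 0`, prime-free admissible sequences exist for
  all large `x` (`FordMaynard.PrimeFreeAdmissible γ θ ν B`).

Everything here is PROVED (no named facts, no `sorry`); the analytic input is the tree's PROVED
prime number theorem with a log-power error term in the form
`|ϑ(y) − y| ≤ C_A y/(log y)^A` (`Literature.NumberTheory.LFunctions.Mertens.exists_abs_theta_sub_le_div_log_pow`,
from `ChebyshevThetaDeLaValleePoussin_holds`) and Mertens' second theorem with a log-power error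
(`Literature.NumberTheory.LFunctions.Mertens.abs_sum_primesLE_inv_sub_loglog_le`).

## The construction (Ford–Maynard's, with block-wise balancing)

Fix `γ < α₁ < α₂ < min(1/2, 1 − θ − ν)` with `[α₁, α₂]` below `θ` (case `γ < θ`) or above
`θ + ν` (case `θ + ν < γ`). At height `x` put `H = ⌊x/2⌋`, `X = ⌊x⌋`, `L = ⌊x/(4 (log x)^B)⌋`,
`P_i = ⌊x^{α_i}⌋`, and cut `(H, X]` into `J = ⌈(X − H)/L⌉` blocks `(H + jL, H + (j+1)L]`.
The *almost-primes* are the `n = p q`, `p ≤ q` primes, `P₁ < p ≤ P₂` (`FordMaynard.IsPQ`,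
recognised through `p = minFac n`). The sequence (`FordMaynard.BlockData.seqA`) is

* `a_p = 0` at the primes of `(H, H + JL]` (so `w_p = a_p − 1 = −1`),
* `a_n = 1 + π_j/N_j` at the almost-primes of block `j` (`π_j`, `N_j` = number of primes, of
  almost-primes, in block `j`),
* `a_n = 1` at every other `n`.

Then every full block has total weight `∑ w_n = 0`, so all prefix sums `∑_{H < n ≤ t} w_n` are
bounded by `L` and every interval sum inside `(x/2, x]` by `2L ≤ x/(2 (log x)^B)`: this is the
`m = 1` term of (I). Every divisor of an almost-prime `p q > x/2` other than `1, pq` is `p` or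
`q ≍ x/p > x^{1−α₂}/2`, both outside `[2, x^γ]` and outside the Type-II range
`((x/2)^θ, x^{θ+ν}]`; primes `> x/2 > x^{θ+ν}` have no such divisor either. Hence the `m ≥ 2`
terms of (I) and the whole Type-II form (II) vanish identically. Boundedness `a_n ≤ 1 + C₁`
uniformly in `x` is the analytic heart (`FordMaynard.exists_block_bound`): in every block,
`#primes · log x ≤ 3L` (PNT at height `≍ x` in intervals of length `L`) while
`#almost-primes · log x ≥ (log(α₂/α₁)/8) L` (PNT at heights `≍ x^{1−α}` for the cofactor `q` of
each `p`, summed with `∑_{P₁ < p ≤ P₂} 1/p ≥ ½ log(α₂/α₁)` by Mertens).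

Ford–Maynard's printed proof takes the constant weight `w_{pq} = 1/K`,
`K = ∫_{α−ε}^{α+ε} du/(u(1−u))`, and invokes "the prime number theorem" for the `m = 1` term;
since the local density of the `pq`'s relative to the primes drifts by `O(1/log x)` across
`(x/2, x]`, a constant weight balances interval sums only to `O(x/log² x)`, so for `B > 2` we
balance block by block instead (same support, same mechanism, weights still bounded uniformly).
The printed "`w_n = 1` otherwise" is read as `w_n = 0` (i.e. `a_n = 1`), as the two verification
sentences of the printed proof require.

## References

* K. Ford, J. Maynard, *On the theory of prime producing sieves*, arXiv:2407.14368 (2024),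
  §4.5, Theorem 4.16 and its proof (`lit read paper:arxiv-2407.14368`, chunks 15–16).
  [FordMaynard2024PrimeSieves]
* H. L. Montgomery, R. C. Vaughan, *Multiplicative Number Theory I*, CUP 2007, Thm 6.9 and §6.2
  (the prime number theorem with error term; Mertens with error term). [MontgomeryVaughan2007]
-/

noncomputable section

open Filter Finset Real

namespace Literature.Barriers.Parity

namespace FordMaynard

/-! ### Products `p · q` of two primes, recognised by their least prime factor -/

/-- `IsPQ P₁ P₂ n`: the least prime factor `p = minFac n` of `n` lies in the window `(P₁, P₂]`
and the cofactor `q = n / p` is prime — i.e. `n = p q` with primes `p ≤ q` and `P₁ < p ≤ P₂`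
(the almost-primes carrying the positive weight in the proof of Ford–Maynard's Theorem 4.16).
[folklore] -/
def IsPQ (P₁ P₂ n : ℕ) : Prop :=
  P₁ < n.minFac ∧ n.minFac ≤ P₂ ∧ (n / n.minFac).Prime

/-- `IsPQ P₁ P₂` is decidable (a conjunction of decidable predicates). [folklore] -/
instance (P₁ P₂ : ℕ) : DecidablePred (IsPQ P₁ P₂) := fun n => by
  unfold IsPQ; infer_instance

namespace IsPQ

variable {P₁ P₂ n : ℕ}

/-- An `IsPQ` number is not `1` (when `P₁ ≥ 1`). [folklore] -/
theorem ne_one (h : IsPQ P₁ P₂ n) (hP : 1 ≤ P₁) : n ≠ 1 := by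
  rintro rfl
  have := h.1
  rw [Nat.minFac_one] at this
  omega

/-- The least prime factor of an `IsPQ` number is prime. [folklore] -/
theorem minFac_prime (h : IsPQ P₁ P₂ n) (hP : 1 ≤ P₁) : n.minFac.Prime :=
  Nat.minFac_prime (h.ne_one hP)

/-- `n = p · q` with `p = minFac n`, `q = n / minFac n`. [folklore] -/
theorem mul_eq (_h : IsPQ P₁ P₂ n) : n.minFac * (n / n.minFac) = n :=
  Nat.mul_div_cancel' (Nat.minFac_dvd n)

/-- `p ≤ q`. [folklore] -/
theorem minFac_le_div (h : IsPQ P₁ P₂ n) : n.minFac ≤ n / n.minFac :=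
  Nat.minFac_le_of_dvd h.2.2.two_le (Nat.div_dvd_of_dvd (Nat.minFac_dvd n))

/-- An `IsPQ` number is not prime. [folklore] -/
theorem not_prime (h : IsPQ P₁ P₂ n) : ¬n.Prime := fun hp => by
  have h3 := h.2.2
  rw [hp.minFac_eq, Nat.div_self hp.pos] at h3
  exact Nat.not_prime_one h3

/-- The divisors of `n = p q` are `1, p, q, n`. [folklore] -/
theorem eq_of_dvd (h : IsPQ P₁ P₂ n) (hP : 1 ≤ P₁) {m : ℕ} (hm : m ∣ n) :
    m = 1 ∨ m = n.minFac ∨ m = n / n.minFac ∨ m = n := by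
  have hp := h.minFac_prime hP
  have hq := h.2.2
  have hn := h.mul_eq
  rw [← hn] at hm
  obtain ⟨y, z, hy, hz, rfl⟩ := Nat.dvd_mul.mp hm
  rcases (Nat.dvd_prime hp).mp hy with rfl | rfl <;>
    rcases (Nat.dvd_prime hq).mp hz with rfl | rfl
  · left; ring
  · right; right; left; ring
  · right; left; ring
  · right; right; right; exact hn

end IsPQ

/-- For primes `p ≤ q`, `minFac (p q) = p`. [folklore] -/
theorem minFac_mul_eq {p q : ℕ} (hp : p.Prime) (hq : q.Prime) (hpq : p ≤ q) :
    (p * q).minFac = p := by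
  refine le_antisymm (Nat.minFac_le_of_dvd hp.two_le (dvd_mul_right p q)) ?_
  have key : p * q = 1 ∨ p ≤ (p * q).minFac :=
    (Nat.le_minFac (m := p) (n := p * q)).mpr fun r hr hrd => by
      rcases (Nat.Prime.dvd_mul hr).mp hrd with h | h
      · exact ((Nat.prime_dvd_prime_iff_eq hr hp).mp h).ge
      · exact hpq.trans ((Nat.prime_dvd_prime_iff_eq hr hq).mp h).ge
  rcases key with h1 | h2
  · exfalso
    have : 2 * 2 ≤ p * q := Nat.mul_le_mul hp.two_le hq.two_le
    omega
  · exact h2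

/-- For primes `p ≤ q` with `P₁ < p ≤ P₂`, `p q` is an `IsPQ P₁ P₂` number. [folklore] -/
theorem isPQ_mul {P₁ P₂ p q : ℕ} (hp : p.Prime) (hq : q.Prime) (hpq : p ≤ q) (h₁ : P₁ < p)
    (h₂ : p ≤ P₂) : IsPQ P₁ P₂ (p * q) := by
  have hmf := minFac_mul_eq hp hq hpq
  refine ⟨by rw [hmf]; exact h₁, by rw [hmf]; exact h₂, ?_⟩
  rw [hmf, Nat.mul_div_cancel_left q hp.pos]
  exact hq

/-! ### The block construction (combinatorial core) -/

/-- Data of the block construction at one height: the weights live on `(H, H + J L]`, cut into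
`J` blocks `(H + jL, H + (j+1)L]` of length `L ≥ 1`; the almost-primes are the `IsPQ P₁ P₂`
numbers, `P₁ ≥ 1`. [folklore] -/
structure BlockData where
  /-- offset: the weights live above `H` (in the application `H = ⌊x/2⌋`) -/
  H : ℕ
  /-- block length -/
  L : ℕ
  /-- number of blocks -/
  J : ℕ
  /-- lower end (excluded) of the window of least prime factors -/
  P₁ : ℕ
  /-- upper end (included) of the window of least prime factors -/
  P₂ : ℕ
  /-- blocks are non-empty -/
  L_pos : 0 < L
  /-- the window excludes `1` -/
  one_le_P₁ : 1 ≤ P₁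

namespace BlockData

variable (D : BlockData)

/-- Block `j`: the integers in `(H + jL, H + jL + L]`. [folklore] -/
def blk (j : ℕ) : Finset ℕ := Ioc (D.H + j * D.L) (D.H + j * D.L + D.L)

/-- Number of primes in block `j`. [folklore] -/
def primeCard (j : ℕ) : ℕ := ((D.blk j).filter Nat.Prime).card

/-- Number of almost-primes (`IsPQ` numbers) in block `j`. [folklore] -/
def pqCard (j : ℕ) : ℕ := ((D.blk j).filter (IsPQ D.P₁ D.P₂)).card

/-- The weight put on each almost-prime of block `j`: `#primes / #almost-primes` of the block
(`0` if there are no almost-primes, by `x / 0 = 0`). [folklore] -/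
def ratio (j : ℕ) : ℝ := D.primeCard j / D.pqCard j

/-- The top `H + J L` of the range carrying weights. [folklore] -/
def top : ℕ := D.H + D.J * D.L

/-- **The sequence** `a_n`: on `(H, H + JL]`, `a_p = 0` at primes, `a_n = 1 + ratio` at the
almost-primes of each block, `a_n = 1` at all other `n`; `a_n = 1` outside `(H, H + JL]`.
[folklore] -/
def seqA (n : ℕ) : ℝ :=
  if D.H < n ∧ n ≤ D.top then
    if n.Prime then 0 else if IsPQ D.P₁ D.P₂ n then 1 + D.ratio ((n - (D.H + 1)) / D.L) else 1
  else 1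

/-- `w_n = a_n - 1`. [folklore] -/
def w (n : ℕ) : ℝ := D.seqA n - 1

/-- The balancing hypothesis with constant `C₁`: in every block, `#primes ≤ C₁ · #almost-primes`.
[folklore] -/
def Balanced (C₁ : ℝ) : Prop := ∀ j < D.J, (D.primeCard j : ℝ) ≤ C₁ * D.pqCard j

/-- Membership in block `j`. [folklore] -/
theorem mem_blk {j n : ℕ} : n ∈ D.blk j ↔ D.H + j * D.L < n ∧ n ≤ D.H + j * D.L + D.L := by
  simp [blk]

/-- A block has `L` elements. [folklore] -/
theorem card_blk (j : ℕ) : (D.blk j).card = D.L := by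
  simp [blk]

/-- At most `L` primes in a block. [folklore] -/
theorem primeCard_le (j : ℕ) : D.primeCard j ≤ D.L :=
  (card_filter_le _ _).trans (D.card_blk j).le

/-- The block index of an element of block `j` is `j`. [folklore] -/
theorem blockIndex_eq {j n : ℕ} (hn : n ∈ D.blk j) : (n - (D.H + 1)) / D.L = j := by
  rw [mem_blk] at hn
  apply Nat.div_eq_of_lt_le
  · omega
  · rw [Nat.succ_mul]; omega

/-- Blocks `j < J` lie in `(H, H + JL]`. [folklore] -/
theorem mem_range_of_mem_blk {j : ℕ} (hj : j < D.J) {n : ℕ} (hn : n ∈ D.blk j) :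
    D.H < n ∧ n ≤ D.top := by
  rw [mem_blk] at hn
  refine ⟨by omega, ?_⟩
  have : (j + 1) * D.L ≤ D.J * D.L := Nat.mul_le_mul_right _ hj
  rw [Nat.succ_mul] at this
  rw [top]; omega

/-- The weight `w_n` on block `j < J`: `-1` at primes, `ratio j` at almost-primes, `0` else.
[folklore] -/
theorem w_eq_of_mem_blk {j : ℕ} (hj : j < D.J) {n : ℕ} (hn : n ∈ D.blk j) :
    D.w n = if n.Prime then -1 else if IsPQ D.P₁ D.P₂ n then D.ratio j else 0 := by
  have h1 := D.mem_range_of_mem_blk hj hn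
  have h2 := D.blockIndex_eq hn
  unfold w seqA
  rw [if_pos h1, h2]
  split_ifs <;> ring

/-- Sum of the weights over a subset `S` of block `j < J`:
`-#(primes in S) + ratio j · #(almost-primes in S)`. [folklore] -/
theorem sum_w_of_subset_blk {j : ℕ} (hj : j < D.J) {S : Finset ℕ} (hS : S ⊆ D.blk j) :
    ∑ n ∈ S, D.w n =
      -((S.filter Nat.Prime).card : ℝ) + D.ratio j * (S.filter (IsPQ D.P₁ D.P₂)).card := by
  have key : ∀ n ∈ S, D.w n =
      -(if n.Prime then (1 : ℝ) else 0) + D.ratio j * (if IsPQ D.P₁ D.P₂ n then 1 else 0) := by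
    intro n hn
    rw [D.w_eq_of_mem_blk hj (hS hn)]
    by_cases hp : n.Prime
    · have hnq : ¬IsPQ D.P₁ D.P₂ n := fun h => h.not_prime hp
      simp [hp, hnq]
    · by_cases hq : IsPQ D.P₁ D.P₂ n <;> simp [hp, hq]
  rw [sum_congr rfl key, sum_add_distrib, sum_neg_distrib, ← mul_sum, sum_boole, sum_boole]

/-- `ratio j ≥ 0`. [folklore] -/
theorem ratio_nonneg (j : ℕ) : 0 ≤ D.ratio j := by
  unfold ratio; positivity

/-- `ratio j · #almost-primes ≤ #primes` (with equality unless there are no almost-primes).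
[folklore] -/
theorem ratio_mul_pqCard_le (j : ℕ) : D.ratio j * D.pqCard j ≤ D.primeCard j := by
  unfold ratio
  rcases Nat.eq_zero_or_pos (D.pqCard j) with h | h
  · rw [h, Nat.cast_zero, mul_zero]; positivity
  · rw [div_mul_cancel₀ _ (by exact_mod_cast h.ne')]

/-- Under the balancing hypothesis, `ratio j · #almost-primes = #primes` for `j < J`.
[folklore] -/
theorem ratio_mul_pqCard_eq {C₁ : ℝ} (hB : D.Balanced C₁) {j : ℕ} (hj : j < D.J) :
    D.ratio j * D.pqCard j = D.primeCard j := by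
  unfold ratio
  rcases Nat.eq_zero_or_pos (D.pqCard j) with h | h
  · have h' := hB j hj
    rw [h, Nat.cast_zero, mul_zero] at h'
    have h0 : D.primeCard j = 0 := by exact_mod_cast le_antisymm h' (Nat.cast_nonneg _)
    rw [h, h0]; simp
  · rw [div_mul_cancel₀ _ (by exact_mod_cast h.ne')]

/-- Under the balancing hypothesis, `ratio j ≤ C₁` for `j < J`. [folklore] -/
theorem ratio_le {C₁ : ℝ} (hB : D.Balanced C₁) (hC : 0 ≤ C₁) {j : ℕ} (hj : j < D.J) :
    D.ratio j ≤ C₁ := by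
  unfold ratio
  rcases Nat.eq_zero_or_pos (D.pqCard j) with h | h
  · rw [h, Nat.cast_zero, div_zero]; exact hC
  · rw [div_le_iff₀ (by exact_mod_cast h)]; exact hB j hj

/-- Every full block `j < J` has total weight `0`. [folklore] -/
theorem sum_blk_eq_zero {C₁ : ℝ} (hB : D.Balanced C₁) {j : ℕ} (hj : j < D.J) :
    ∑ n ∈ D.blk j, D.w n = 0 := by
  rw [D.sum_w_of_subset_blk hj subset_rfl]
  have := D.ratio_mul_pqCard_eq hB hj
  unfold primeCard pqCard at this
  linarith

/-- A part of a block `j < J` has total weight in `[-L, L]`. [folklore] -/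
theorem abs_sum_le_of_subset_blk {j : ℕ} (hj : j < D.J) {S : Finset ℕ} (hS : S ⊆ D.blk j) :
    |∑ n ∈ S, D.w n| ≤ D.L := by
  rw [D.sum_w_of_subset_blk hj hS, abs_le]
  have h1 : ((S.filter Nat.Prime).card : ℝ) ≤ D.primeCard j := by
    exact_mod_cast card_le_card (filter_subset_filter _ hS)
  have h2 : ((S.filter (IsPQ D.P₁ D.P₂)).card : ℝ) ≤ D.pqCard j := by
    exact_mod_cast card_le_card (filter_subset_filter _ hS)
  have h3 := D.ratio_mul_pqCard_le j
  have h4 := D.ratio_nonneg j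
  have h5 : (D.primeCard j : ℝ) ≤ D.L := by exact_mod_cast D.primeCard_le j
  have h6 : 0 ≤ D.ratio j * (S.filter (IsPQ D.P₁ D.P₂)).card := by positivity
  have h7 : D.ratio j * (S.filter (IsPQ D.P₁ D.P₂)).card ≤ D.ratio j * D.pqCard j :=
    mul_le_mul_of_nonneg_left h2 h4
  have h8 : (0 : ℝ) ≤ (S.filter Nat.Prime).card := Nat.cast_nonneg _
  constructor <;> linarith

/-- The prefix sums vanish at block boundaries `H + jL`, `j ≤ J`. [folklore] -/
theorem sum_Ioc_boundary_eq_zero {C₁ : ℝ} (hB : D.Balanced C₁) {j : ℕ} (hj : j ≤ D.J) :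
    ∑ n ∈ Ioc D.H (D.H + j * D.L), D.w n = 0 := by
  induction j with
  | zero => simp
  | succ j ih =>
    have h1 : D.H + j * D.L ≤ D.H + (j + 1) * D.L := by rw [Nat.succ_mul]; omega
    rw [← sum_Ioc_consecutive _ (Nat.le_add_right D.H (j * D.L)) h1,
      ih (Nat.le_of_succ_le hj)]
    have h2 : Ioc (D.H + j * D.L) (D.H + (j + 1) * D.L) = D.blk j := by
      rw [blk, Nat.succ_mul, add_assoc]
    rw [h2, D.sum_blk_eq_zero hB hj, add_zero]

/-- **All prefix sums are small**: `|∑_{H < n ≤ t} w_n| ≤ L` for `H ≤ t ≤ H + JL`. [folklore] -/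
theorem abs_sum_Ioc_le {C₁ : ℝ} (hB : D.Balanced C₁) {t : ℕ} (ht : D.H ≤ t) (htE : t ≤ D.top) :
    |∑ n ∈ Ioc D.H t, D.w n| ≤ D.L := by
  have hL := D.L_pos
  have hdiv := Nat.div_add_mod (t - D.H) D.L
  have hmod := Nat.mod_lt (t - D.H) hL
  have htop : D.top = D.H + D.J * D.L := rfl
  set j := (t - D.H) / D.L with hj
  set ρ := (t - D.H) % D.L with hρ
  have ht' : t = D.H + j * D.L + ρ := by
    have : D.L * j = j * D.L := mul_comm _ _
    omega
  by_cases hρ0 : ρ = 0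
  · have hjJ : j ≤ D.J := by
      by_contra hcon
      push Not at hcon
      have : D.J * D.L + D.L ≤ j * D.L := by
        have := Nat.mul_le_mul_right D.L hcon
        rw [Nat.succ_mul] at this
        exact this
      omega
    rw [show t = D.H + j * D.L by omega, D.sum_Ioc_boundary_eq_zero hB hjJ, abs_zero]
    positivity
  · have hjJ : j < D.J := by
      by_contra hcon
      push Not at hcon
      have : D.J * D.L ≤ j * D.L := Nat.mul_le_mul_right D.L hcon
      omega
    rw [← sum_Ioc_consecutive _ (by omega : D.H ≤ D.H + j * D.L) (by omega : D.H + j * D.L ≤ t),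
      D.sum_Ioc_boundary_eq_zero hB hjJ.le, zero_add]
    refine D.abs_sum_le_of_subset_blk hjJ fun n hn => ?_
    rw [mem_Ioc] at hn
    rw [mem_blk]
    omega

/-- **Interval sums are small**: for `X ≤ H + JL` and any `u, v`,
`|∑_{H < n ≤ X, u ≤ n ≤ v} w_n| ≤ 2L`. [folklore] -/
theorem abs_sum_filter_le {C₁ : ℝ} (hB : D.Balanced C₁) {X : ℕ} (hX : X ≤ D.top) (u v : ℕ) :
    |∑ n ∈ (Ioc D.H X).filter (fun n => u ≤ n ∧ n ≤ v), D.w n| ≤ 2 * D.L := by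
  set a := max D.H (u - 1) with ha
  set b := min X v with hb
  have hset : (Ioc D.H X).filter (fun n => u ≤ n ∧ n ≤ v) = Ioc a b := by
    ext n
    simp only [mem_filter, mem_Ioc, ha, hb]
    omega
  rw [hset]
  rcases le_or_gt a b with hab | hab
  · have hHa : D.H ≤ a := le_max_left _ _
    have hbX : b ≤ X := min_le_left _ _
    have h := sum_Ioc_consecutive D.w hHa hab
    have e : ∑ n ∈ Ioc a b, D.w n = ∑ n ∈ Ioc D.H b, D.w n - ∑ n ∈ Ioc D.H a, D.w n := by
      linarith
    rw [e]
    have h1 := D.abs_sum_Ioc_le hB hHa (hab.trans (hbX.trans hX))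
    have h2 := D.abs_sum_Ioc_le hB (hHa.trans hab) (hbX.trans hX)
    calc |∑ n ∈ Ioc D.H b, D.w n - ∑ n ∈ Ioc D.H a, D.w n|
        ≤ |∑ n ∈ Ioc D.H b, D.w n| + |∑ n ∈ Ioc D.H a, D.w n| := abs_sub _ _
      _ ≤ D.L + D.L := add_le_add h2 h1
      _ = 2 * D.L := by ring
  · rw [Ioc_eq_empty (by omega), sum_empty, abs_zero]
    positivity

/-- `a_p = 0` at the primes of `(H, H + JL]`. [folklore] -/
theorem seqA_prime {p : ℕ} (hp : p.Prime) (h1 : D.H < p) (h2 : p ≤ D.top) : D.seqA p = 0 := by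
  unfold seqA
  rw [if_pos ⟨h1, h2⟩, if_pos hp]

/-- `a_n ≥ 0`. [folklore] -/
theorem seqA_nonneg (n : ℕ) : 0 ≤ D.seqA n := by
  unfold seqA
  have := D.ratio_nonneg ((n - (D.H + 1)) / D.L)
  split_ifs <;> linarith

/-- `a_n ≤ 1 + C₁` under the balancing hypothesis. [folklore] -/
theorem seqA_le {C₁ : ℝ} (hB : D.Balanced C₁) (hC : 0 ≤ C₁) (n : ℕ) : D.seqA n ≤ 1 + C₁ := by
  unfold seqA
  split_ifs with h1 h2 h3
  · linarith
  · have hj : (n - (D.H + 1)) / D.L < D.J := by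
      rw [Nat.div_lt_iff_lt_mul D.L_pos]
      have := h1.2
      rw [top] at this
      omega
    linarith [D.ratio_le hB hC hj]
  · linarith
  · linarith

/-- `a_n = 1` at every `n` that is neither prime nor an almost-prime. [folklore] -/
theorem seqA_eq_one {n : ℕ} (h : ¬n.Prime) (h' : ¬IsPQ D.P₁ D.P₂ n) : D.seqA n = 1 := by
  unfold seqA
  simp [h, h']

end BlockData

/-! ### Prime counts in blocks: the analytic input -/

section Analytic

open Literature.NumberTheory.Sieve.MaynardSieve in
/-- `#{primes in (s, t]} · log(s + 1) ≤ ϑ(t) − ϑ(s)`. [folklore] -/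
theorem card_primes_Ioc_mul_log_le {s t : ℕ} (hst : s ≤ t) :
    (((Ioc s t).filter Nat.Prime).card : ℝ) * Real.log ((s : ℝ) + 1) ≤
      Chebyshev.theta t - Chebyshev.theta s := by
  rw [theta_sub_theta_eq_sum hst]
  exact card_mul_log_le_sum

open Literature.NumberTheory.Sieve.MaynardSieve in
/-- `ϑ(t) − ϑ(s) ≤ #{primes in (s, t]} · log t`. [folklore] -/
theorem theta_sub_theta_le_card_primes_Ioc_mul_log {s t : ℕ} (hst : s ≤ t) :
    Chebyshev.theta t - Chebyshev.theta s ≤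
      (((Ioc s t).filter Nat.Prime).card : ℝ) * Real.log t := by
  rw [theta_sub_theta_eq_sum hst]
  exact sum_le_card_mul_log

/-- **Pairs inject into almost-primes.** For the block `(s, s + L]` with `P₂² ≤ s`, the map
`(p, q) ↦ p q` on pairs of primes `p ∈ (P₁, P₂]`, `q ∈ (s/p, (s+L)/p]` is injective with values
among the `IsPQ P₁ P₂` numbers of `(s, s + L]`; hence
`∑_p #{q} ≤ #{IsPQ numbers in (s, s+L]}`. [folklore] -/
theorem sum_card_fiber_le {P₁ P₂ s L : ℕ} (hsep : P₂ * P₂ ≤ s) :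
    ∑ p ∈ (Ioc P₁ P₂).filter Nat.Prime,
        (((Ioc (s / p) ((s + L) / p)).filter Nat.Prime).card : ℝ) ≤
      ((Ioc s (s + L)).filter (IsPQ P₁ P₂)).card := by
  have key : ∀ p ∈ (Ioc P₁ P₂).filter Nat.Prime,
      ∀ q ∈ (Ioc (s / p) ((s + L) / p)).filter Nat.Prime,
        p.Prime ∧ q.Prime ∧ p < q ∧ P₁ < p ∧ p ≤ P₂ ∧ s < p * q ∧ p * q ≤ s + L := by
    intro p hp q hq
    simp only [mem_filter, mem_Ioc] at hp hq
    obtain ⟨⟨hp1, hp2⟩, hpp⟩ := hp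
    obtain ⟨⟨hq1, hq2⟩, hqq⟩ := hq
    have hp0 := hpp.pos
    refine ⟨hpp, hqq, ?_, hp1, hp2, ?_, ?_⟩
    · have h1 : P₂ ≤ s / p := by
        rw [Nat.le_div_iff_mul_le hp0]
        exact (Nat.mul_le_mul_left P₂ hp2).trans hsep
      omega
    · rw [mul_comm]; exact (Nat.div_lt_iff_lt_mul hp0).mp hq1
    · rw [mul_comm]; exact (Nat.le_div_iff_mul_le hp0).mp hq2
  have h := card_le_card_of_injOn (s := ((Ioc P₁ P₂).filter Nat.Prime).sigma
      fun p => (Ioc (s / p) ((s + L) / p)).filter Nat.Prime)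
    (t := (Ioc s (s + L)).filter (IsPQ P₁ P₂)) (fun z => z.1 * z.2) ?_ ?_
  · rw [card_sigma] at h
    exact_mod_cast h
  · rintro ⟨p, q⟩ hz
    rw [Finset.mem_coe, mem_sigma] at hz
    obtain ⟨hpp, hqq, hpq, hp1, hp2, hs1, hs2⟩ := key p hz.1 q hz.2
    rw [Finset.mem_coe, mem_filter, mem_Ioc]
    exact ⟨⟨hs1, hs2⟩, isPQ_mul hpp hqq hpq.le hp1 hp2⟩
  · rintro ⟨p, q⟩ hz ⟨p', q'⟩ hz' h
    change p * q = p' * q' at h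
    rw [Finset.mem_coe, mem_sigma] at hz hz'
    obtain ⟨hpp, hqq, hpq, -⟩ := key p hz.1 q hz.2
    obtain ⟨hpp', hqq', hpq', -⟩ := key p' hz'.1 q' hz'.2
    have h1 : p = p' := by
      have := minFac_mul_eq hpp hqq hpq.le
      rw [h, minFac_mul_eq hpp' hqq' hpq'.le] at this
      exact this.symm
    subst h1
    have h2 : q = q' := Nat.eq_of_mul_eq_mul_left hpp.pos h
    subst h2
    rfl

/-- Monotonicity of the error term in the logarithm: if `0 < a ≤ log y` then
`C y/(log y)^A ≤ C y/a^A` (`C, y ≥ 0`). [folklore] -/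
theorem err_mono {C y a : ℝ} {A : ℕ} (hC : 0 ≤ C) (hy : 0 ≤ y) (ha : 0 < a)
    (hab : a ≤ Real.log y) : C * y / Real.log y ^ A ≤ C * y / a ^ A :=
  div_le_div_of_nonneg_left (by positivity) (by positivity) (pow_le_pow_left₀ ha.le hab A)

/-- For `x ≥ 16` and `y ≥ x/4`: `log y ≥ (log x)/2`. [folklore] -/
theorem half_log_le_log {x y : ℝ} (hx : 16 ≤ x) (hy : x / 4 ≤ y) :
    Real.log x / 2 ≤ Real.log y := by
  have hx0 : 0 < x := by linarith
  have h4 : Real.log 16 = 2 * Real.log 4 := by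
    rw [show (16 : ℝ) = 4 ^ 2 by norm_num, Real.log_pow]; norm_num
  have h16 : Real.log 16 ≤ Real.log x := Real.log_le_log (by norm_num) hx
  calc Real.log x / 2 ≤ Real.log x - Real.log 4 := by linarith
    _ = Real.log (x / 4) := by rw [Real.log_div hx0.ne' (by norm_num)]
    _ ≤ Real.log y := Real.log_le_log (by positivity) hy

/-- For `x ≥ 256` and `y ≥ x^{1/2}/4`: `log y ≥ (log x)/4`. [folklore] -/
theorem quarter_log_le_log {x y : ℝ} (hx : 256 ≤ x) (hy : x ^ (1 / 2 : ℝ) / 4 ≤ y) :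
    Real.log x / 4 ≤ Real.log y := by
  have hx0 : 0 < x := by linarith
  have h4 : Real.log 256 = 4 * Real.log 4 := by
    rw [show (256 : ℝ) = 4 ^ 4 by norm_num, Real.log_pow]; norm_num
  have h256 : Real.log 256 ≤ Real.log x := Real.log_le_log (by norm_num) hx
  calc Real.log x / 4 ≤ Real.log x / 2 - Real.log 4 := by linarith
    _ = Real.log (x ^ (1 / 2 : ℝ) / 4) := by
        rw [Real.log_div (by positivity) (by norm_num), Real.log_rpow hx0]; ring
    _ ≤ Real.log y := Real.log_le_log (by positivity) hy

/-- The error term at heights `y ∈ [x/4, 2x]` (`x ≥ 16`):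
`C y/(log y)^A ≤ 2^{A+1} C · x/(log x)^A`. [folklore] -/
theorem err_high {C x y : ℝ} {A : ℕ} (hC : 0 ≤ C) (hx : 16 ≤ x) (hy1 : x / 4 ≤ y)
    (hy2 : y ≤ 2 * x) : C * y / Real.log y ^ A ≤ 2 ^ (A + 1) * C * (x / Real.log x ^ A) := by
  have hx0 : 0 < x := by linarith
  have hlx : 0 < Real.log x := Real.log_pos (by linarith)
  have hy0 : 0 ≤ y := by linarith
  calc C * y / Real.log y ^ A ≤ C * y / (Real.log x / 2) ^ A :=
        err_mono hC hy0 (by positivity) (half_log_le_log hx hy1)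
    _ ≤ C * (2 * x) / (Real.log x / 2) ^ A := by gcongr
    _ = 2 ^ (A + 1) * C * (x / Real.log x ^ A) := by
        rw [div_pow]
        field_simp
        ring

/-- The error term at heights `y ∈ [x^{1/2}/4, Y]` (`x ≥ 256`, `Y ≥ 0`):
`C y/(log y)^A ≤ 4^A C · Y/(log x)^A`. [folklore] -/
theorem err_low {C x y Y : ℝ} {A : ℕ} (hC : 0 ≤ C) (hx : 256 ≤ x)
    (hy1 : x ^ (1 / 2 : ℝ) / 4 ≤ y) (hy2 : y ≤ Y) :
    C * y / Real.log y ^ A ≤ 4 ^ A * C * (Y / Real.log x ^ A) := by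
  have hx0 : 0 < x := by linarith
  have hlx : 0 < Real.log x := Real.log_pos (by linarith)
  have hy0 : 0 ≤ y := le_trans (by positivity) hy1
  calc C * y / Real.log y ^ A ≤ C * y / (Real.log x / 4) ^ A :=
        err_mono hC hy0 (by positivity) (quarter_log_le_log hx hy1)
    _ ≤ C * Y / (Real.log x / 4) ^ A := by gcongr
    _ = 4 ^ A * C * (Y / Real.log x ^ A) := by
        rw [div_pow]
        field_simp

/-- **Primes in a block** `(s, s + L]`, `x/4 ≤ s ≤ x`, `L ≤ x/4`, from
`|ϑ(y) − y| ≤ C y/(log y)^A`: if `2^{A+3} C x/(log x)^A ≤ L` then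
`#{primes} · log x ≤ 3 L`. [folklore] -/
theorem card_primes_block_mul_log_le {C x : ℝ} {A s L : ℕ} (hC0 : 0 ≤ C)
    (hC : ∀ y : ℝ, 2 ≤ y → |Chebyshev.theta y - y| ≤ C * y / Real.log y ^ A)
    (hx : 256 ≤ x) (hs1 : x / 4 ≤ s) (hs2 : (s : ℝ) ≤ x) (hLx : (L : ℝ) ≤ x / 4)
    (hLlow : 2 ^ (A + 3) * C * (x / Real.log x ^ A) ≤ L) :
    (((Ioc s (s + L)).filter Nat.Prime).card : ℝ) * Real.log x ≤ 3 * L := by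
  have h1 := card_primes_Ioc_mul_log_le (Nat.le_add_right s L)
  push_cast at h1
  have h2 := (abs_le.mp (hC ((s : ℝ) + L) (by linarith))).2
  have h3 := (abs_le.mp (hC s (by linarith))).1
  have h4 := err_high (A := A) hC0 (by linarith) (by linarith : x / 4 ≤ (s : ℝ) + L) (by linarith)
  have h5 := err_high (A := A) hC0 (by linarith) hs1 (by linarith)
  have h6 : Real.log x / 2 ≤ Real.log ((s : ℝ) + 1) :=
    half_log_le_log (by linarith) (by linarith)
  have h7 := mul_le_mul_of_nonneg_left h6
    (Nat.cast_nonneg ((Ioc s (s + L)).filter Nat.Prime).card)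
  have h8 : (2 : ℝ) ^ (A + 3) = 4 * 2 ^ (A + 1) := by ring
  rw [h8] at hLlow
  linarith

/-- **The fibre over one prime** `p ≤ x^{1/2}` of the block `(s, s + L]` (`x/4 ≤ s`,
`s + L ≤ 2x`): if `2 · 4^{A+1} C x/(log x)^A ≤ L` then
`L/(2p) ≤ #{primes q ∈ (s/p, (s+L)/p]} · log(2x)`. [folklore] -/
theorem div_le_card_fiber_mul_log {C x : ℝ} {A s L p : ℕ} (hC0 : 0 ≤ C)
    (hC : ∀ y : ℝ, 2 ≤ y → |Chebyshev.theta y - y| ≤ C * y / Real.log y ^ A)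
    (hx : 256 ≤ x) (hs1 : x / 4 ≤ s) (hsL : (s : ℝ) + L ≤ 2 * x) (hp : p.Prime)
    (hpx : (p : ℝ) ≤ x ^ (1 / 2 : ℝ)) (hLlow : 2 * 4 ^ (A + 1) * C * (x / Real.log x ^ A) ≤ L) :
    (L : ℝ) / (2 * p) ≤
      (((Ioc (s / p) ((s + L) / p)).filter Nat.Prime).card : ℝ) * Real.log (2 * x) := by
  have hx0 : 0 < x := by linarith
  have hp0 : (0 : ℝ) < p := by exact_mod_cast hp.pos
  set t : ℕ := s + L with htdef
  have htcast : (t : ℝ) = s + L := by rw [htdef]; push_cast; ring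
  have hst : s ≤ t := Nat.le_add_right s L
  have hab : s / p ≤ t / p := Nat.div_le_div_right hst
  have hsqrt : x ^ (1 / 2 : ℝ) * x ^ (1 / 2 : ℝ) = x := by
    rw [← Real.rpow_add hx0]; norm_num
  -- heights `s/p ≤ t/p`
  have hys : x ^ (1 / 2 : ℝ) / 4 ≤ (s : ℝ) / p := by
    rw [div_le_div_iff₀ (by norm_num) hp0]
    calc x ^ (1 / 2 : ℝ) * p ≤ x ^ (1 / 2 : ℝ) * x ^ (1 / 2 : ℝ) :=
          mul_le_mul_of_nonneg_left hpx (Real.rpow_nonneg hx0.le _)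
      _ = x := hsqrt
      _ ≤ s * 4 := by linarith
  have h16 : 16 ≤ x ^ (1 / 2 : ℝ) := by
    nlinarith [Real.rpow_nonneg hx0.le (1 / 2 : ℝ)]
  have hys2 : (2 : ℝ) ≤ (s : ℝ) / p := le_trans (by linarith) hys
  have hyt : (s : ℝ) / p ≤ (t : ℝ) / p := div_le_div_of_nonneg_right (by exact_mod_cast hst) hp0.le
  have hθ : Chebyshev.theta ↑(t / p) - Chebyshev.theta ↑(s / p) =
      Chebyshev.theta ((t : ℝ) / p) - Chebyshev.theta ((s : ℝ) / p) := by
    rw [Chebyshev.theta_eq_theta_coe_floor ((t : ℝ) / p),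
      Chebyshev.theta_eq_theta_coe_floor ((s : ℝ) / p), Nat.floor_div_eq_div,
      Nat.floor_div_eq_div]
  have h1 := theta_sub_theta_le_card_primes_Ioc_mul_log hab
  have h2 := (abs_le.mp (hC _ (hys2.trans hyt))).1
  have h3 := (abs_le.mp (hC _ hys2)).2
  have h4 := err_low (A := A) hC0 hx (hys.trans hyt) le_rfl
  have h5 := err_low (A := A) hC0 hx hys hyt
  have hdiff : (t : ℝ) / p - (s : ℝ) / p = L / p := by rw [htcast]; ring
  have hlx : 0 < Real.log x := Real.log_pos (by linarith)
  have hY : (t : ℝ) / p / Real.log x ^ A ≤ 2 * (x / Real.log x ^ A) / p := by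
    calc (t : ℝ) / p / Real.log x ^ A ≤ 2 * x / p / Real.log x ^ A :=
          div_le_div_of_nonneg_right (div_le_div_of_nonneg_right (by rw [htcast]; exact hsL)
            hp0.le) (pow_nonneg hlx.le A)
      _ = 2 * (x / Real.log x ^ A) / p := by ring
  have hE : 4 ^ A * C * ((t : ℝ) / p / Real.log x ^ A) +
      4 ^ A * C * ((t : ℝ) / p / Real.log x ^ A) ≤ (L : ℝ) / (2 * p) := by
    have h6 : 4 ^ A * C * ((t : ℝ) / p / Real.log x ^ A) ≤
        4 ^ A * C * (2 * (x / Real.log x ^ A) / p) :=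
      mul_le_mul_of_nonneg_left hY (by positivity)
    have h7 : 4 ^ A * C * (2 * (x / Real.log x ^ A) / p) +
        4 ^ A * C * (2 * (x / Real.log x ^ A) / p) =
          (2 * 4 ^ (A + 1) * C * (x / Real.log x ^ A)) / (2 * p) := by
      field_simp
      ring
    have h8 : (2 * 4 ^ (A + 1) * C * (x / Real.log x ^ A)) / (2 * p) ≤ (L : ℝ) / (2 * p) :=
      div_le_div_of_nonneg_right hLlow (by positivity)
    linarith
  -- `log b ≤ log (2x)`
  set F : ℕ := ((Ioc (s / p) (t / p)).filter Nat.Prime).card with hF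
  have hlogb : (F : ℝ) * Real.log ↑(t / p) ≤ F * Real.log (2 * x) := by
    refine mul_le_mul_of_nonneg_left ?_ (Nat.cast_nonneg _)
    rcases Nat.eq_zero_or_pos (t / p) with hb0 | hb0
    · rw [hb0, Nat.cast_zero, Real.log_zero]; exact Real.log_nonneg (by linarith)
    · refine Real.log_le_log (by exact_mod_cast hb0) ?_
      calc ((t / p : ℕ) : ℝ) ≤ (t : ℝ) / p := Nat.cast_div_le
        _ ≤ t := div_le_self (Nat.cast_nonneg _) (by exact_mod_cast hp.one_lt.le)
        _ ≤ 2 * x := by rw [htcast]; exact hsL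
  rw [hθ] at h1
  have hL2 : (L : ℝ) / (2 * p) = L / p / 2 := by ring
  linarith

/-- **Almost-primes in a block** `(s, s + L]` (`x/4 ≤ s`, `s + L ≤ 2x`, `P₂ ≤ x^{1/2}`,
`P₂² ≤ s`): if `2 · 4^{A+1} C x/(log x)^A ≤ L` and `∑_{P₁ < p ≤ P₂} 1/p ≥ c₀` then
`c₀ L/4 ≤ #{IsPQ P₁ P₂ numbers} · log x`. [folklore] -/
theorem mul_le_card_pq_block_mul_log {C x c₀ : ℝ} {A s L P₁ P₂ : ℕ} (hC0 : 0 ≤ C)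
    (hC : ∀ y : ℝ, 2 ≤ y → |Chebyshev.theta y - y| ≤ C * y / Real.log y ^ A)
    (hx : 256 ≤ x) (hs1 : x / 4 ≤ s) (hsL : (s : ℝ) + L ≤ 2 * x)
    (hP₂ : (P₂ : ℝ) ≤ x ^ (1 / 2 : ℝ)) (hsep : P₂ * P₂ ≤ s)
    (hLlow : 2 * 4 ^ (A + 1) * C * (x / Real.log x ^ A) ≤ L)
    (hmert : c₀ ≤ ∑ p ∈ (Ioc P₁ P₂).filter Nat.Prime, (p : ℝ)⁻¹) :
    c₀ * L / 4 ≤ (((Ioc s (s + L)).filter (IsPQ P₁ P₂)).card : ℝ) * Real.log x := by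
  have hx0 : 0 < x := by linarith
  have hfib : ∀ p ∈ (Ioc P₁ P₂).filter Nat.Prime, (L : ℝ) / (2 * p) ≤
      (((Ioc (s / p) ((s + L) / p)).filter Nat.Prime).card : ℝ) * Real.log (2 * x) := by
    intro p hp
    simp only [mem_filter, mem_Ioc] at hp
    exact div_le_card_fiber_mul_log hC0 hC hx hs1 hsL hp.2
      ((Nat.cast_le.mpr hp.1.2).trans hP₂) hLlow
  have h1 := sum_le_sum hfib
  rw [← sum_mul] at h1
  have h2 : ∑ p ∈ (Ioc P₁ P₂).filter Nat.Prime, (L : ℝ) / (2 * p) =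
      (L : ℝ) / 2 * ∑ p ∈ (Ioc P₁ P₂).filter Nat.Prime, (p : ℝ)⁻¹ := by
    rw [mul_sum]
    refine sum_congr rfl fun p _ => ?_
    ring
  rw [h2] at h1
  have h3 : (L : ℝ) / 2 * c₀ ≤ (L : ℝ) / 2 * ∑ p ∈ (Ioc P₁ P₂).filter Nat.Prime, (p : ℝ)⁻¹ :=
    mul_le_mul_of_nonneg_left hmert (by positivity)
  have h4 : Real.log (2 * x) ≤ 2 * Real.log x := by
    rw [Real.log_mul (by norm_num) hx0.ne']
    have : Real.log 2 ≤ Real.log x := Real.log_le_log (by norm_num) (by linarith)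
    linarith
  have hsum := sum_card_fiber_le (P₁ := P₁) (L := L) hsep
  have h5 := mul_le_mul hsum h4 (Real.log_nonneg (by linarith)) (Nat.cast_nonneg _)
  linarith

/-- **The block length** `L = ⌊x/(4 (log x)^B)⌋`: for `log x ≥ 1`, `(log x)^{N+1} ≤ x`
(`N = ⌈B⌉`), `B ≥ 0` and `log x ≥ 4(M + 2)` (`M ≥ 0`) one has
`M x/(log x)^{N+1} + 1 ≤ L ≤ x/4`. [folklore] -/
theorem blockLen_bounds {x B M : ℝ} (hx : 1 < x) (hlx : 1 ≤ Real.log x) (hB : 0 ≤ B)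
    (hM : 0 ≤ M) (hΦ : Real.log x ^ (⌈B⌉₊ + 1) ≤ x) (hlogM : 4 * (M + 2) ≤ Real.log x) :
    M * (x / Real.log x ^ (⌈B⌉₊ + 1)) + 1 ≤ ⌊x / Real.log x ^ B / 4⌋₊ ∧
      (⌊x / Real.log x ^ B / 4⌋₊ : ℝ) ≤ x / 4 := by
  have hx0 : 0 < x := by linarith
  have hlx0 : 0 < Real.log x := by linarith
  set N : ℕ := ⌈B⌉₊ with hN
  set Φ : ℝ := x / Real.log x ^ (N + 1) with hΦdef
  have hΦ1 : 1 ≤ Φ := by rw [hΦdef, le_div_iff₀ (by positivity), one_mul]; exact hΦ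
  set Lr : ℝ := x / Real.log x ^ B / 4 with hLr
  have hLr0 : 0 ≤ Lr := by positivity
  have hpowB : Real.log x ^ B ≤ Real.log x ^ N := by
    rw [← Real.rpow_natCast]
    exact Real.rpow_le_rpow_of_exponent_le hlx (Nat.le_ceil B)
  have hΦlog : Φ * Real.log x = x / Real.log x ^ N := by
    rw [hΦdef, pow_succ]
    field_simp
  have hLr1 : Φ * Real.log x / 4 ≤ Lr := by
    rw [hΦlog, hLr]
    exact div_le_div_of_nonneg_right
      (div_le_div_of_nonneg_left hx0.le (Real.rpow_pos_of_pos hlx0 B) hpowB) (by norm_num)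
  constructor
  · have h1 : Lr < ⌊Lr⌋₊ + 1 := Nat.lt_floor_add_one Lr
    have h2 : Φ * (4 * (M + 2)) ≤ Φ * Real.log x := mul_le_mul_of_nonneg_left hlogM (by linarith)
    linarith
  · have h1 : (⌊Lr⌋₊ : ℝ) ≤ Lr := Nat.floor_le hLr0
    have h2 : Lr ≤ x / 1 / 4 := by
      rw [hLr]
      exact div_le_div_of_nonneg_right
        (div_le_div_of_nonneg_left hx0.le one_pos (Real.one_le_rpow hlx hB)) (by norm_num)
    rw [div_one] at h2
    linarith

/-- For `a < b` and any `c`: eventually `c · x^a ≤ x^b`. [folklore] -/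
theorem eventually_mul_rpow_le_rpow {a b : ℝ} (c : ℝ) (hab : a < b) :
    ∀ᶠ x : ℝ in atTop, c * x ^ a ≤ x ^ b := by
  filter_upwards [(tendsto_rpow_atTop (sub_pos.mpr hab)).eventually_ge_atTop c,
    eventually_gt_atTop (0 : ℝ)] with x hx hx0
  calc c * x ^ a ≤ x ^ (b - a) * x ^ a :=
        mul_le_mul_of_nonneg_right hx (Real.rpow_nonneg hx0.le a)
    _ = x ^ b := by rw [← Real.rpow_add hx0]; ring_nf

open Literature.NumberTheory.LFunctions.Mertens in
/-- **Mertens on a window of fixed logarithmic width**: for `0 < α₁ < α₂`, eventually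
`∑_{x^{α₁} < p ≤ x^{α₂}} 1/p ≥ ½ log(α₂/α₁)` (from the tree's PROVED Mertens theorem with a
log-power error, `abs_sum_primesLE_inv_sub_loglog_le`). [folklore] -/
theorem eventually_le_sum_inv_primes {α₁ α₂ : ℝ} (h0 : 0 < α₁) (h12 : α₁ < α₂) :
    ∀ᶠ x : ℝ in atTop, Real.log (α₂ / α₁) / 2 ≤
      ∑ p ∈ (Ioc ⌊x ^ α₁⌋₊ ⌊x ^ α₂⌋₊).filter Nat.Prime, (p : ℝ)⁻¹ := by
  obtain ⟨K, hK⟩ := abs_sum_primesLE_inv_sub_loglog_le 1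
  have hα₂ : 0 < α₂ := h0.trans h12
  have hlog : 0 < Real.log (α₂ / α₁) := Real.log_pos (by rw [one_lt_div h0]; exact h12)
  have e1 : ∀ᶠ x : ℝ in atTop, 2 ≤ x ^ α₁ := (tendsto_rpow_atTop h0).eventually_ge_atTop 2
  have e2 : ∀ᶠ x : ℝ in atTop, 2 * (|K| / α₁ + |K| / α₂) / Real.log (α₂ / α₁) ≤ Real.log x :=
    Real.tendsto_log_atTop.eventually_ge_atTop _
  filter_upwards [e1, e2, eventually_ge_atTop (2 : ℝ)] with x hx1 hx2 hx
  have hx0 : 0 < x := by linarith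
  have hlx : 0 < Real.log x := Real.log_pos (by linarith)
  have hxα₂ : x ^ α₁ ≤ x ^ α₂ := Real.rpow_le_rpow_of_exponent_le (by linarith) h12.le
  set P₁ := ⌊x ^ α₁⌋₊ with hP₁
  set P₂ := ⌊x ^ α₂⌋₊ with hP₂
  have hP : P₁ ≤ P₂ := Nat.floor_le_floor hxα₂
  have hsplit : ∑ p ∈ (Ioc P₁ P₂).filter Nat.Prime, (p : ℝ)⁻¹ =
      ∑ p ∈ Nat.primesLE P₂, (p : ℝ)⁻¹ - ∑ p ∈ Nat.primesLE P₁, (p : ℝ)⁻¹ := by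
    have hsub : Nat.primesLE P₁ ⊆ Nat.primesLE P₂ := fun p hp => by
      rw [Nat.mem_primesLE] at hp ⊢; exact ⟨hp.1.trans hP, hp.2⟩
    have hset : (Ioc P₁ P₂).filter Nat.Prime = Nat.primesLE P₂ \ Nat.primesLE P₁ := by
      ext p
      simp only [Finset.mem_sdiff, Nat.mem_primesLE, mem_filter, mem_Ioc]
      constructor
      · rintro ⟨⟨h1, h2⟩, h3⟩; exact ⟨⟨h2, h3⟩, fun h => by omega⟩
      · rintro ⟨⟨h1, h2⟩, h3⟩
        refine ⟨⟨?_, h1⟩, h2⟩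
        by_contra h
        exact h3 ⟨by omega, h2⟩
    rw [hset, sum_sdiff_eq_sub hsub]
  have h2K := hK (x ^ α₂) (hx1.trans hxα₂)
  have h1K := hK (x ^ α₁) hx1
  rw [pow_one, Real.log_rpow hx0, Real.log_mul hα₂.ne' hlx.ne'] at h2K
  rw [pow_one, Real.log_rpow hx0, Real.log_mul h0.ne' hlx.ne'] at h1K
  rw [hsplit]
  have hb2 := abs_le.mp h2K
  have hb1 := abs_le.mp h1K
  have hk2 : K / (α₂ * Real.log x) ≤ |K| / α₂ / Real.log x := by
    rw [div_div]; exact div_le_div_of_nonneg_right (le_abs_self K) (by positivity)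
  have hk1 : K / (α₁ * Real.log x) ≤ |K| / α₁ / Real.log x := by
    rw [div_div]; exact div_le_div_of_nonneg_right (le_abs_self K) (by positivity)
  have hlogdiv : Real.log (α₂ / α₁) = Real.log α₂ - Real.log α₁ := Real.log_div hα₂.ne' h0.ne'
  have hmain : (|K| / α₁ + |K| / α₂) / Real.log x ≤ Real.log (α₂ / α₁) / 2 := by
    rw [div_le_iff₀ hlx]
    have := (div_le_iff₀ hlog).mp hx2
    nlinarith
  have : |K| / α₁ / Real.log x + |K| / α₂ / Real.log x = (|K| / α₁ + |K| / α₂) / Real.log x := by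
    ring
  linarith [hb2.1, hb1.2]

open Literature.NumberTheory.LFunctions.Mertens in
/-- **Primes versus almost-primes in blocks** (the analytic heart of the proof of Theorem 4.16,
from the tree's PROVED prime number theorem with log-power error `|ϑ(y) − y| ≤ C y/(log y)^A`
and Mertens' theorem): for `0 < α₁ < α₂ < 1/2` and `B ≥ 0` there is `C₁ ≥ 0` such that for
all large `x`, with `L = ⌊x/(4 (log x)^B)⌋ ≥ 1`, every block `(s, s + L]` with
`x/2 − 1 ≤ s ≤ x` contains at most `C₁` times as many primes as `IsPQ ⌊x^{α₁}⌋ ⌊x^{α₂}⌋`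
numbers (primes: `≤ 3L/log x`; almost-primes: `≥ (log(α₂/α₁)/8) L/log x`). [folklore] -/
theorem exists_block_bound {α₁ α₂ B : ℝ} (h0 : 0 < α₁) (h12 : α₁ < α₂) (h2 : α₂ < 1 / 2)
    (hB : 0 ≤ B) :
    ∃ C₁ : ℝ, 0 ≤ C₁ ∧ ∀ᶠ x : ℝ in atTop, 1 ≤ ⌊x / Real.log x ^ B / 4⌋₊ ∧
      ∀ s : ℕ, x / 2 - 1 ≤ s → (s : ℝ) ≤ x →
        (((Ioc s (s + ⌊x / Real.log x ^ B / 4⌋₊)).filter Nat.Prime).card : ℝ) ≤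
          C₁ * ((Ioc s (s + ⌊x / Real.log x ^ B / 4⌋₊)).filter
            (IsPQ ⌊x ^ α₁⌋₊ ⌊x ^ α₂⌋₊)).card := by
  set A : ℕ := ⌈B⌉₊ + 1 with hA
  obtain ⟨C, hC0, hC⟩ := exists_abs_theta_sub_le_div_log_pow A
  set c₀ : ℝ := Real.log (α₂ / α₁) / 2 with hc₀def
  have hc₀ : 0 < c₀ := by
    have : 0 < Real.log (α₂ / α₁) := Real.log_pos (by rw [one_lt_div h0]; exact h12)
    positivity
  set M : ℝ := 8 * 4 ^ A * C with hM
  have hM0 : 0 ≤ M := by positivity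
  refine ⟨12 / c₀, by positivity, ?_⟩
  filter_upwards [eventually_ge_atTop (256 : ℝ),
    (Real.isLittleO_pow_log_id_atTop (n := A)).bound one_pos,
    Real.tendsto_log_atTop.eventually_ge_atTop (4 * (M + 2)),
    eventually_le_sum_inv_primes h0 h12,
    eventually_mul_rpow_le_rpow 4 (by linarith : 2 * α₂ < 1)] with x hx hΦx hlogM hmert hsq
  have hx0 : 0 < x := by linarith
  have hx1 : 1 < x := by linarith
  have hlx : 1 ≤ Real.log x := by
    rw [Real.le_log_iff_exp_le hx0]
    have := Real.exp_one_lt_d9; linarith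
  have hlx0 : 0 < Real.log x := by linarith
  have hΦ' : Real.log x ^ A ≤ x := by
    have := hΦx
    rwa [one_mul, id, Real.norm_of_nonneg (by positivity), Real.norm_of_nonneg hx0.le] at this
  obtain ⟨hLlow, hLx⟩ := blockLen_bounds hx1 hlx hB hM0 hΦ' hlogM
  set L : ℕ := ⌊x / Real.log x ^ B / 4⌋₊ with hLdef
  set Φ : ℝ := x / Real.log x ^ A with hΦdef
  have hΦ0 : 0 ≤ Φ := by positivity
  have hMΦ : 0 ≤ M * Φ := mul_nonneg hM0 hΦ0
  have hL1 : (1 : ℝ) ≤ L := by linarith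
  -- the two thresholds on `L`
  have hLa : 2 ^ (A + 3) * C * Φ ≤ L := by
    have h1 : (2 : ℝ) ^ (A + 3) * C ≤ M := by
      rw [hM, pow_add]
      have h24 : (2 : ℝ) ^ A ≤ 4 ^ A := pow_le_pow_left₀ (by norm_num) (by norm_num) A
      have := mul_le_mul_of_nonneg_right h24 hC0
      norm_num
      linarith
    have := mul_le_mul_of_nonneg_right h1 hΦ0
    linarith
  have hLb : 2 * 4 ^ (A + 1) * C * Φ ≤ L := by
    have h1 : (2 : ℝ) * 4 ^ (A + 1) * C = M := by rw [hM]; ring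
    rw [h1]; linarith
  refine ⟨by exact_mod_cast hL1, fun s hs1 hs2 => ?_⟩
  have hs4 : x / 4 ≤ s := by linarith
  have hsL : (s : ℝ) + L ≤ 2 * x := by linarith
  -- the window of least prime factors
  have hP₂x : (⌊x ^ α₂⌋₊ : ℝ) ≤ x ^ α₂ := Nat.floor_le (Real.rpow_nonneg hx0.le _)
  have hP₂ : (⌊x ^ α₂⌋₊ : ℝ) ≤ x ^ (1 / 2 : ℝ) :=
    hP₂x.trans (Real.rpow_le_rpow_of_exponent_le hx1.le h2.le)
  have hsep : ⌊x ^ α₂⌋₊ * ⌊x ^ α₂⌋₊ ≤ s := by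
    have h1 : (⌊x ^ α₂⌋₊ : ℝ) * ⌊x ^ α₂⌋₊ ≤ x ^ α₂ * x ^ α₂ :=
      mul_le_mul hP₂x hP₂x (Nat.cast_nonneg _) (Real.rpow_nonneg hx0.le _)
    have h2 : x ^ α₂ * x ^ α₂ = x ^ (2 * α₂) := by rw [← Real.rpow_add hx0]; ring_nf
    rw [Real.rpow_one] at hsq
    have : (⌊x ^ α₂⌋₊ : ℝ) * ⌊x ^ α₂⌋₊ ≤ s := by linarith
    exact_mod_cast this
  have hπ := card_primes_block_mul_log_le hC0 hC hx hs4 hs2 hLx hLa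
  have hN := mul_le_card_pq_block_mul_log hC0 hC hx hs4 hsL hP₂ hsep hLb hmert
  -- conclusion: `π log x ≤ 3L = (12/c₀)(c₀ L/4) ≤ (12/c₀) N log x`
  refine le_of_mul_le_mul_right ?_ hlx0
  have h'' : 12 / c₀ * (c₀ * L / 4) = 3 * L := by
    rw [show 12 / c₀ * (c₀ * L / 4) = 3 * L * (c₀ * c₀⁻¹) by ring, mul_inv_cancel₀ hc₀.ne',
      mul_one]
  have h' := mul_le_mul_of_nonneg_left hN (by positivity : (0 : ℝ) ≤ 12 / c₀)
  rw [h''] at h'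
  rw [mul_assoc]
  exact hπ.trans h'

end Analytic


/-! ### Assembly -/

namespace BlockData

/-- The values `a_N = 1` off primes and almost-primes, tested through a divisor: if `m ∣ N` with
`m ≠ 1, N`, `m` outside the window `(P₁, P₂]` and `m` not the prime cofactor of `N`, then `N` is
neither prime nor an almost-prime, so `a_N = 1`. [folklore] -/
theorem seqA_eq_one_of_dvd (D : BlockData) {N m : ℕ} (hm1 : m ≠ 1) (hmN : m ≠ N)
    (hmp : m ≤ D.P₁ ∨ D.P₂ < m) (hmq : ∀ _ : IsPQ D.P₁ D.P₂ N, m ≠ N / N.minFac)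
    (hdvd : m ∣ N) : D.seqA N = 1 := by
  apply D.seqA_eq_one
  · intro hp
    rcases (Nat.dvd_prime hp).mp hdvd with h | h
    · exact hm1 h
    · exact hmN h
  · intro hq
    rcases hq.eq_of_dvd D.one_le_P₁ hdvd with h | h | h | h
    · exact hm1 h
    · rcases hmp with h' | h'
      · have := hq.1; omega
      · have := hq.2.1; omega
    · exact hmq hq h
    · exact hmN h

/-- **The `m = 1` term of (I)**: with `H = ⌊x/2⌋` and `⌊x⌋ ≤ H + JL`, for every interval
`[u, v]`, `|∑_{n ∈ [u,v], x/2 < n ≤ x} (a_n − 1)| ≤ 2L` (stated in the syntactic shape produced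
by unfolding `FordMaynard.TypeI` at `m = 1`). [folklore] -/
theorem abs_sum_one_le (D : BlockData) {C₁ : ℝ} (hB : D.Balanced C₁) {x : ℝ} (hx : 0 ≤ x)
    (hH : D.H = ⌊x / 2⌋₊) (hX : ⌊x⌋₊ ≤ D.top) (u v : ℕ) :
    |∑ n ∈ (Icc u v).filter
        (fun n : ℕ => x / 2 < ((1 : ℕ) : ℝ) * (n : ℝ) ∧ ((1 : ℕ) : ℝ) * (n : ℝ) ≤ x),
        (D.seqA (1 * n) - 1)| ≤ 2 * D.L := by
  have hset : (Icc u v).filter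
      (fun n : ℕ => x / 2 < ((1 : ℕ) : ℝ) * (n : ℝ) ∧ ((1 : ℕ) : ℝ) * (n : ℝ) ≤ x) =
        (Ioc D.H ⌊x⌋₊).filter (fun n => u ≤ n ∧ n ≤ v) := by
    ext n
    simp only [mem_filter, mem_Icc, mem_Ioc, Nat.cast_one, one_mul, hH]
    rw [Nat.floor_lt (by positivity), Nat.le_floor_iff hx]
    tauto
  rw [hset]
  simp only [one_mul]
  exact D.abs_sum_filter_le hB hX u v

end BlockData

/-- **The construction works** (proof of Theorem 4.16 for a fixed admissible window): for
`0 < γ < α₁ < α₂ < 1/2`, `θ ≥ 0`, `θ + ν < 1 − α₂`, and `[α₁, α₂]` off the Type-II range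
(`α₂ < θ` or `θ + ν < α₁`), prime-free admissible sequences exist at `(γ, θ, ν, B)` for every
`B > 0`. [cite: FordMaynard2024PrimeSieves, Theorem 4.16 (proof)] -/
theorem primeFreeAdmissible_of_window {γ θ ν B α₁ α₂ : ℝ} (hγ0 : 0 < γ) (hγα : γ < α₁)
    (h12 : α₁ < α₂) (h2 : α₂ < 1 / 2) (hθ0 : 0 ≤ θ) (hθνα : θ + ν < 1 - α₂)
    (hsep : α₂ < θ ∨ θ + ν < α₁) (hB : 0 < B) :
    PrimeFreeAdmissible γ θ ν B := by
  have hα₁ : 0 < α₁ := hγ0.trans hγα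
  obtain ⟨C₁, hC₁, hev⟩ := exists_block_bound hα₁ h12 h2 hB.le
  have e3 : ∀ᶠ x : ℝ in atTop, α₂ < θ → (2 : ℝ) ^ θ * x ^ α₂ ≤ x ^ θ := by
    rcases em (α₂ < θ) with h | h
    · exact (eventually_mul_rpow_le_rpow _ h).mono fun x hx _ => hx
    · exact Eventually.of_forall fun x h' => absurd h' h
  obtain ⟨x₀, hx₀⟩ := Filter.eventually_atTop.mp (hev.and ((eventually_ge_atTop (256 : ℝ)).and
    ((eventually_mul_rpow_le_rpow 4 hθνα).and ((eventually_mul_rpow_le_rpow 2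
      (by linarith : θ + ν < 1)).and ((eventually_mul_rpow_le_rpow 2
        (by linarith : γ < 1)).and e3)))))
  refine ⟨1 + C₁, x₀, fun x hx => ?_⟩
  obtain ⟨⟨hL1, hblock⟩, h256, he1, he2, he5, hcaseA⟩ := hx₀ x hx
  rw [Real.rpow_one] at he2 he5
  have hx0 : 0 < x := by linarith
  have hx1 : 1 < x := by linarith
  have hlx0 : 0 < Real.log x := Real.log_pos hx1
  -- the data of the construction
  set L : ℕ := ⌊x / Real.log x ^ B / 4⌋₊ with hLdef
  set H : ℕ := ⌊x / 2⌋₊ with hHdef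
  set X : ℕ := ⌊x⌋₊ with hXdef
  set P₁ : ℕ := ⌊x ^ α₁⌋₊ with hP₁def
  set P₂ : ℕ := ⌊x ^ α₂⌋₊ with hP₂def
  set J : ℕ := (X - H + L - 1) / L with hJdef
  have hP₁ : 1 ≤ P₁ := Nat.le_floor (by rw [Nat.cast_one]; exact Real.one_le_rpow hx1.le hα₁.le)
  have hXH : H ≤ X := Nat.floor_le_floor (by linarith)
  have hJL : X ≤ H + J * L := by
    have := Nat.lt_div_mul_add (a := X - H + L - 1) hL1
    rw [← hJdef] at this
    omega
  have hJle : J * L ≤ X - H + L - 1 := Nat.div_mul_le_self _ _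
  have hXx : (X : ℝ) ≤ x := Nat.floor_le hx0.le
  have hHx : x / 2 - 1 < H := by
    have := Nat.lt_floor_add_one (x / 2); rw [← hHdef] at this; linarith
  let D : BlockData := ⟨H, L, J, P₁, P₂, hL1, hP₁⟩
  have hBal : D.Balanced C₁ := by
    intro j hj
    have h1 : H + j * L ≤ X := by
      have : (j + 1) * L ≤ J * L := Nat.mul_le_mul_right L hj
      rw [Nat.succ_mul] at this
      omega
    have h2 : ((H + j * L : ℕ) : ℝ) ≤ x := le_trans (by exact_mod_cast h1) hXx
    have h3 : x / 2 - 1 ≤ ((H + j * L : ℕ) : ℝ) := by push_cast; nlinarith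
    exact hblock (H + j * L) h3 h2
  -- useful real bounds
  have hP₂x : (P₂ : ℝ) ≤ x ^ α₂ := Nat.floor_le (Real.rpow_nonneg hx0.le _)
  have hxθν0 : 0 ≤ x ^ (θ + ν) := Real.rpow_nonneg hx0.le _
  refine ⟨D.seqA, fun n => ⟨D.seqA_nonneg n, D.seqA_le hBal hC₁ n⟩, ?_, ?_, ?_⟩
  · -- (I)
    intro I
    have hxγ1 : 1 ≤ ⌊x ^ γ⌋₊ :=
      Nat.le_floor (by rw [Nat.cast_one]; exact Real.one_le_rpow hx1.le hγ0.le)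
    rw [sum_eq_single_of_mem 1 (mem_Icc.mpr ⟨le_rfl, hxγ1⟩) ?_]
    · have hmain := D.abs_sum_one_le hBal hx0.le rfl hJL (I 1).1 (I 1).2
      have hτ : (((1 : ℕ).divisors.card : ℕ) : ℝ) ^ B = 1 := by
        rw [Nat.divisors_one, card_singleton, Nat.cast_one, Real.one_rpow]
      rw [hτ, one_mul]
      have hLr : (L : ℝ) ≤ x / Real.log x ^ B / 4 := Nat.floor_le (by positivity)
      have h0 : 0 ≤ x / Real.log x ^ B := by positivity
      refine hmain.trans ?_
      show 2 * (L : ℝ) ≤ _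
      linarith
    · intro m hm hm1
      rw [mem_Icc] at hm
      refine mul_eq_zero_of_right _ (abs_eq_zero.mpr (sum_eq_zero fun n hn => ?_))
      simp only [mem_filter, mem_Icc] at hn
      show D.seqA (m * n) - 1 = 0
      rw [sub_eq_zero]
      have hmP₁ : m ≤ P₁ :=
        hm.2.trans (Nat.floor_le_floor (Real.rpow_le_rpow_of_exponent_le hx1.le hγα.le))
      have hmx : (m : ℝ) ≤ x ^ γ := (Nat.cast_le.mpr hm.2).trans (Nat.floor_le (by positivity))
      refine D.seqA_eq_one_of_dvd hm1 ?_ (Or.inl hmP₁) ?_ (Dvd.intro n rfl)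
      · intro h
        have h' : (m : ℝ) = (m : ℝ) * n := by exact_mod_cast h
        linarith [hn.2.1]
      · intro hq h
        have h1 := hq.minFac_le_div
        have h2 := hq.1
        change P₁ < (m * n).minFac at h2
        omega
  · -- (II)
    intro ξ κ _ _
    rw [sum_eq_zero fun m hm => sum_eq_zero fun n hn => ?_]
    · rw [norm_zero]; positivity
    simp only [mem_filter, mem_Icc] at hm hn
    have hm1r : (1 : ℝ) < m := lt_of_le_of_lt (Real.one_le_rpow (by linarith) hθ0) hm.2
    have hmx : (m : ℝ) ≤ x ^ (θ + ν) := (Nat.cast_le.mpr hm.1.2).trans (Nat.floor_le hxθν0)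
    have h1 : D.seqA (m * n) = 1 := by
      refine D.seqA_eq_one_of_dvd ?_ ?_ ?_ ?_ (Dvd.intro n rfl)
      · intro h; rw [h, Nat.cast_one] at hm1r; exact lt_irrefl _ hm1r
      · intro h
        have h' : (m : ℝ) = (m : ℝ) * n := by exact_mod_cast h
        linarith [hn.2.1]
      · rcases hsep with hA | hB'
        · right
          have h2θ : (0 : ℝ) < 2 ^ θ := Real.rpow_pos_of_pos (by norm_num) θ
          have h3 : x ^ α₂ ≤ (x / 2) ^ θ := by
            rw [Real.div_rpow hx0.le (by norm_num), le_div_iff₀ h2θ, mul_comm]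
            exact hcaseA hA
          have : (P₂ : ℝ) < m := by linarith [hm.2]
          exact_mod_cast this
        · left
          exact hm.1.2.trans (Nat.floor_le_floor
            (Real.rpow_le_rpow_of_exponent_le hx1.le (by linarith)))
      · intro hq h
        have hpx : ((m * n).minFac : ℝ) ≤ x ^ α₂ := (Nat.cast_le.mpr hq.2.1).trans hP₂x
        have hNpq : (((m * n).minFac : ℕ) : ℝ) * ((m * n / (m * n).minFac : ℕ) : ℝ) =
            (m : ℝ) * n := by exact_mod_cast hq.mul_eq
        rw [← h] at hNpq
        have h3 : (m : ℝ) * n ≤ x ^ α₂ * m := by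
          rw [← hNpq]; exact mul_le_mul_of_nonneg_right hpx (Nat.cast_nonneg m)
        have h4 : x ^ α₂ * (m : ℝ) ≤ x ^ α₂ * x ^ (θ + ν) :=
          mul_le_mul_of_nonneg_left hmx (Real.rpow_nonneg hx0.le _)
        have h5 : x ^ α₂ * x ^ (1 - α₂) = x := by
          rw [← Real.rpow_add hx0]; norm_num
        have h6 := mul_le_mul_of_nonneg_left he1 (Real.rpow_nonneg hx0.le α₂)
        linarith [hn.2.1]
    simp [h1]
  · -- no primes
    intro p hp h1 h2
    exact D.seqA_prime hp ((Nat.floor_lt (by positivity)).mpr h1) ((Nat.le_floor h2).trans hJL)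

end FordMaynard

/-- **Ford–Maynard, Theorem 4.16** (`C⁻(γ, θ, ν) = 0` below Type-I level `1/2`), PROVED:
the named fact `FordMaynardLowLevel` holds — for `(γ, θ, ν) ∈ 𝒬₀` with `γ < 1/2`,
`γ ∉ [θ, θ + ν]`, `γ < 1 − θ − ν` and every `B > 0` there are `C`, `x₀` such that for all
`x ≥ x₀` some non-negative `C`-bounded sequence `(a_n)` has `w = a − 1` satisfying (I) at level
`x^γ` and (II) on `[θ, θ + ν]` while `a_p = 0` at every prime `p ∈ (x/2, x]`. The window
`[α₁, α₂]` of `FordMaynard.primeFreeAdmissible_of_window` is placed in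
`(γ, min(θ, 1/2, 1 − θ − ν))` if `γ < θ`, in `(γ, min(1/2, 1 − θ − ν))` if `θ + ν < γ`.
[cite: FordMaynard2024PrimeSieves, Theorem 4.16] -/
theorem FordMaynardLowLevel_holds : FordMaynardLowLevel := by
  intro γ θ ν B hγ0 hγ hθ0 _ _ _ hoff hrefl hB
  rcases hoff with h | h
  · set u : ℝ := min θ (min (1 / 2) (1 - θ - ν)) with hu
    have hγu : γ < u := lt_min h (lt_min hγ hrefl)
    have huθ : u ≤ θ := min_le_left _ _
    have hu2 : u ≤ 1 / 2 := (min_le_right _ _).trans (min_le_left _ _)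
    have hu3 : u ≤ 1 - θ - ν := (min_le_right _ _).trans (min_le_right _ _)
    exact FordMaynard.primeFreeAdmissible_of_window (α₁ := γ + (u - γ) / 3)
      (α₂ := γ + 2 * (u - γ) / 3) hγ0 (by linarith) (by linarith) (by linarith) hθ0 (by linarith)
      (Or.inl (by linarith)) hB
  · set u : ℝ := min (1 / 2) (1 - θ - ν) with hu
    have hγu : γ < u := lt_min hγ hrefl
    have hu2 : u ≤ 1 / 2 := min_le_left _ _
    have hu3 : u ≤ 1 - θ - ν := min_le_right _ _
    exact FordMaynard.primeFreeAdmissible_of_window (α₁ := γ + (u - γ) / 3)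
      (α₂ := γ + 2 * (u - γ) / 3) hγ0 (by linarith) (by linarith) (by linarith) hθ0 (by linarith)
      (Or.inr (by linarith)) hB

end Literature.Barriers.Parity
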